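import Literature.NumberTheory.LFunctions.WeilTwoPrimePos59Def
import HarnessLib

/-!
# Two-prime positivity certificate (a₀ = 59/100): the value of `κ` and the scalar side conditions

Kernel evaluation of `kappaQ` and `checkScalars`. Pure proof file.
-/

noncomputable section

namespace Literature.NumberTheory.LFunctions

set_option maxHeartbeats 0 in
/-- **The value of `κ`** of the positivity certificate (= that of certificate E). [folklore] -/
theorem kappaQ_weilCert23P : weilCert23P.kappaQ = weilCert23EKappaLit := by
  have h : decide (weilCert23P.kappaQ = weilCert23EKappaLit) = true := by decide +kernel
  exact of_decide_eq_true h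

set_option maxHeartbeats 0 in
/-- **Kernel check of the scalar side conditions** of the positivity certificate. [folklore] -/
theorem checkScalars_weilCert23P : weilCert23P.checkScalars = true := by
  have h : weilCert23P.checkScalars = (decide (1 ≤ weilCert23P.j) && decide (0 < weilCert23P.b) && decide (weilCert23P.b ≤ weilCert23P.base.a0) &&
      decide (weilCert23P.base.a0 ≤ 1) && decide (0 < weilCert23P.base.T) && decide (2 * weilCert23P.base.a0 * weilCert23P.base.T ≤ (weilCert23P.base.N : ℚ) + 2) &&
      decide (2 * (weilCert23P.base.a0 * weilCert23P.base.T) ^ (weilCert23P.base.N + 1) / (weilCert23P.base.N + 1).factorial ≤ 1) &&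
      decide (weilCert23P.base.N + 1 = 2 * weilCert23P.base.nb) && decide (0 ≤ weilCert23P.kappaQ)) := rfl
  rw [h, kappaQ_weilCert23P]
  decide +kernel

end Literature.NumberTheory.LFunctions
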